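import Literature.NumberTheory.DiophantineGeometry.TateAlgorithm
import Literature.NumberTheory.GaloisRepresentations.UnramifiedKummer
import Mathlib.AlgebraicGeometry.EllipticCurve.Affine.Point
import Mathlib.GroupTheory.Index
import HarnessLib

/-!
# Kramer–Tunnell 1982, §6: the local norm index `dim E(F)/N E(K)` for an UNRAMIFIED quadratic
# extension `K/F` of local fields (any residue characteristic, `2` included) — Lemma 6.1 AS PRINTED,
# with the exact vanishing printed inside its proof

Source: K. Kramer, J. Tunnell, *Elliptic curves and local ε-factors*, Compositio Math. 46 (1982)
307–352 (NUMDAM `CM_1982__46_3_307_0`; PUBLISHED, refereed), §6 "Unramified extensions", printed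
pp. 327–328 (= PDF p0022–p0023 of the copy materialised on the hub as `paper:url-f1c2eb36a995`;
locators `pNNNN Lk` below). ONE named fact (`def … : Prop`, D-0014, nothing asserted) recording
Lemma 6.1 together with the sentence of its proof that the cell `bsd-uniform` (track U2, the Selmer
transport at additive places incl. `v = 2`; `pub/bsd-uniform/u2/INGREDIENTS.md` §4, flags F4–F5)
actually consumes, plus two definitions with bodies (the norm subgroup and the fixed subgroup) and one
proved API lemma. Not in Mathlib or the tree (2026-08-22: the tree's `Kramer…` files are Kramer 1981 /
1983; `Summits/…/O6/NormIndexTower.lean` types a DIFFERENT norm index, along the cyclotomic tower, as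
an interface).

## The printed text, verbatim

[p0022 L2–L23 = p. 327] "6. Unramified extensions. Let `E` be an elliptic curve having minimal
discriminant `Δ` over the local field `F`, with finite residue field `k_F`. Let `K/F` be an unramified
quadratic extension with corresponding character `ω`. We now verify conjecture (3.1) that
`ε(E, ω) = ω(−Δ)(−1)^{dim E(F)/NE(K)}`. In view of the previous section, we could assume that
`char(k_F) = 2`. However, we present a uniform proof. Let `E_0` be the connected component of the
identity in the Neron minimal model for `E`. It follows from Lang's theorem [9] that
`N : E_0(K) → E_0(F)` is surjective. Let `X` be the 2-Sylow subgroup of `E(K)/E_0(K)`. Let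
`G = Gal(K/F)`. Then
LEMMA 6.1: Let `M` be the maximal unramified extension of `F` and let `n` be the number of components
in the singular fiber of `E` over `M`. Then `dim E(F)/NE(K) ≡ n − 1 (mod 2)`.
PROOF: The table [17, p. 46] gives `n` and `c = |E(M)/E_0(M)|`. For reductions of type `I_0`, `I_v`
with `v_F(Δ) = v` odd, `II`, `II*`, `IV`, `IV*`, `c` is odd and `n` is odd. Since `X` must be trivial,
`dim E(F)/NE(K) = 0`. Hence `dim E(F)/NE(K) ≡ n − 1 (mod 2)`. For reduction of type `III` or `III*`,
`X ≅ ℤ/2ℤ` and `n` is even. Hence `dim H^0(G, X) = 1 ≡ n − 1` as desired. …" ([17] = Tate,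
*Algorithm for determining the type of a singular fiber in an elliptic pencil*, LNM 476.)
Notation [p0002 = p. 307]: "Let `N` be the norm homomorphism from `E(K)` to `E(F)` which assigns to
`P` … the sum `P + gP`, where `g` generates `Gal(K/F)`"; "`dim(E(F)/NE(K))` is the `F_2`-dimension
of the two-group `E(F)/NE(K)`" [p0003 = p. 308: "The `F_2`-dimension of a 2-group `A` is denoted
`dim(A)`"]. In the proofs the authors identify `E(F)/NE(K) ≅ Ĥ^0(G, E(K))` [p0021 L43 = p. 326:
"Hence `E(F)/NE(K) ≃ H°(G, E(K))`", reduced cohomology].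

## Transcription (Mathlib / tree vocabulary; nothing re-declared)

* `F`: a nonarchimedean local field in Mathlib's sense (`[ValuativeRel F] [TopologicalSpace F]
  [IsNonarchimedeanLocalField F]`, finite residue field of ANY characteristic — the printed "we could
  assume that `char(k_F) = 2` … uniform proof"), ring of integers `𝒪[F]`; `E : WeierstrassCurve F`
  elliptic (any model: the statement is model-independent; the "minimal discriminant `Δ`" enters only
  `ω(−Δ)` of Thm 6.2, not Lemma 6.1).
* `K/F` unramified quadratic: an intermediate field `K'` of `F̄/F` contained in the tree's maximal
  unramified extension `maxUnramified F = F(μ_{p'})` (`UnramifiedKummer.lean`; Serre, *Local Fields*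
  IV §4: `K_nr`; the source's `M`) with `[K' : F] = 2`; `g = σ`, an `F`-automorphism of `K'` with
  `σ ≠ 1` (the generator of `G = Gal(K'/F)`, of order `2`), acting on `E(K')` by transport of
  coordinates (`WeierstrassCurve.Affine.Point.map`).
* `E(F)/NE(K)`: the printed `Ĥ^0(G, E(K))` — the subgroup `E(K')^{σ}` of `σ`-fixed points
  (`fixedSubgroup`; it is `E(F)`: Galois descent for points, `K'^σ = F`) modulo the norms `{P + σP}`
  (`normSubgroup`, contained in it: `normSubgroup_le_fixedSubgroup`); its ORDER is the relative index
  `AddSubgroup.relIndex (normSubgroup) (fixedSubgroup)` (Mathlib; `0` would encode an infinite index,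
  which Cor. 7.3.1 of the source excludes — the fact asserts a power of `2`); "dim" = the exponent `d`
  in `#(E(F)/NE(K)) = 2^d` (an `F_2`-space: `2·P = N(P)` for `P ∈ E(F)`).
* `n` = "the number of components in the singular fiber of `E` over `M`" = the number of irreducible
  components of the geometric special fibre = `(E.kodairaSymbol 𝒪[F]).numComponents` (tree
  `TateAlgorithm.lean` / `KodairaSymbol.lean`: Tate's algorithm over the complete DVR `𝒪[F]`, whose
  residue field is finite hence perfect, returns the Kodaira–Néron type of the special fibre — a
  geometric invariant, unchanged over `M` — and `numComponents` counts components over `k̄`: Table 4.1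
  of Silverman *ATAEC* IV = the table [17] of the source); the reduction types of the exact clause are
  the constructors `I 0`, `I v` (`v` odd), `II`, `IIstar`, `IV`, `IVstar` of the tree's `KodairaSymbol`.

Faithfulness: clause (i) is Lemma 6.1 verbatim; clause (ii) is the sentence "For reductions of type
`I_0`, `I_v` with `v_F(Δ) = v` odd, `II`, `II*`, `IV`, `IV*` … `dim E(F)/NE(K) = 0`" of its proof,
printed as an unconditional step (Lang's theorem + `c` odd) — recorded because it, not the parity, is
what a Selmer transport consumes. NOT recorded (not printed as such): exact values for `I_0^*`, `I_v^*`,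
`III`, `III*` beyond the parity; Theorem 6.2 (`ε(E, ω) = ω(−Δ)·κ(E, ω)`, which leans on Ogg's formula
mod `2`, Remark p. 328); and the global/Selmer reading (Mazur–Rubin 2010 Lemma 2.9: "`H¹_f` equal ⟺
norm index `0`"), which is a different source. Weaker than print only in fixing `F` to Mathlib's local
fields (the source: any local field with finite residue field — the same class) and `E` given by a
Weierstrass model over `F`.
-/

noncomputable section

open ValuativeRel Field
open Literature.NumberTheory.GaloisRepresentations.IsNonarchimedeanLocalField
open Literature.NumberTheory.DiophantineGeometry

namespace Literature.NumberTheory.EllipticCurves.KramerTunnell1982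

section Defs

variable {F : Type*} [Field F] (E : WeierstrassCurve F) (K' : Type*) [Field K'] [Algebra F K']
  [DecidableEq K'] (σ : K' ≃ₐ[F] K')

/-- The **norm subgroup** `N E(K') = {P + σP : P ∈ E(K')}` of an elliptic curve over a quadratic
extension `K'/F` with non-trivial automorphism `σ` (Kramer–Tunnell 1982, Introduction p. 307: "Let
`N` be the norm homomorphism from `E(K)` to `E(F)` which assigns to `P` … the sum `P + gP`, where `g`
generates `Gal(K/F)`"), as a subgroup of `E(K')`: the range of `P ↦ P + σP`. A definition with a body;
nothing asserted. [cite: KramerTunnell1982, Introduction (p. 307), the norm homomorphism N] -/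
def normSubgroup : AddSubgroup (E.baseChange K').toAffine.Point :=
  (AddMonoidHom.id _ +
    (WeierstrassCurve.Affine.Point.map (W' := E) (σ : K' →ₐ[F] K'))).range

/-- The **`σ`-fixed points** `E(K')^{⟨σ⟩}` (`= E(F)` inside `E(K')` by Galois descent when
`K'^σ = F`), the numerator of the printed `E(F)/NE(K) ≅ Ĥ⁰(G, E(K))` (Kramer–Tunnell 1982, p. 326:
"Hence `E(F)/NE(K) ≃ H°(G, E(K))`"). A definition with a body; nothing asserted.
[cite: KramerTunnell1982, §5 proof of Prop. 5.11 (p. 326), E(F)/NE(K) ≅ Ĥ⁰(G, E(K))] -/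
def fixedSubgroup : AddSubgroup (E.baseChange K').toAffine.Point :=
  (WeierstrassCurve.Affine.Point.map (W' := E) (σ : K' →ₐ[F] K')).eqLocus
    (AddMonoidHom.id _)

variable {E K' σ}

/-- Membership in the norm subgroup: `Q ∈ N E(K') ↔ ∃ P, P + σP = Q` (unfolding of the cited
definition of `N`). [cite: KramerTunnell1982, Introduction (p. 307), the norm homomorphism N (unfolding)] -/
theorem mem_normSubgroup_iff {Q : (E.baseChange K').toAffine.Point} :
    Q ∈ normSubgroup E K' σ ↔
      ∃ P : (E.baseChange K').toAffine.Point,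
        P + WeierstrassCurve.Affine.Point.map (W' := E) (σ : K' →ₐ[F] K') P = Q :=
  Iff.rfl

/-- Membership in the fixed subgroup: `P ∈ E(K')^σ ↔ σP = P` (unfolding of the cited `Ĥ⁰`
numerator). [cite: KramerTunnell1982, §5 proof of Prop. 5.11 (p. 326), E(F)/NE(K) ≅ Ĥ⁰(G, E(K)) (unfolding)] -/
theorem mem_fixedSubgroup_iff {P : (E.baseChange K').toAffine.Point} :
    P ∈ fixedSubgroup E K' σ ↔
      WeierstrassCurve.Affine.Point.map (W' := E) (σ : K' →ₐ[F] K') P = P :=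
  Iff.rfl

/-- `σ` acts on points compatibly with the group law of `Aut(K'/F)`: `(στ)P = σ(τP)` (transport of
coordinates is functorial; definitional, as in the tree's `pointGalHom`). Private helper. [folklore] -/
private theorem map_mul_apply (τ : K' ≃ₐ[F] K') (P : (E.baseChange K').toAffine.Point) :
    WeierstrassCurve.Affine.Point.map (W' := E) ((σ * τ : K' ≃ₐ[F] K') : K' →ₐ[F] K') P =
      WeierstrassCurve.Affine.Point.map (W' := E) (σ : K' →ₐ[F] K')
        (WeierstrassCurve.Affine.Point.map (W' := E) (τ : K' →ₐ[F] K') P) := by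
  cases P <;> rfl

/-- The identity automorphism acts trivially on points (definitional). Private helper. [folklore] -/
private theorem map_one_apply (P : (E.baseChange K').toAffine.Point) :
    WeierstrassCurve.Affine.Point.map (W' := E) ((1 : K' ≃ₐ[F] K') : K' →ₐ[F] K') P = P := by
  cases P <;> rfl

/-- **Norms are fixed**: if `σ² = 1` (the generator of a quadratic Galois group) then
`σ(P + σP) = σP + P`, so `N E(K') ≤ E(K')^{σ}` and the quotient `Ĥ⁰(G, E(K')) = E(F)/NE(K)` of the
source (p. 307: "`N` … from `E(K)` to `E(F)`"; p. 326: "`E(F)/NE(K) ≃ H°(G, E(K))`") is meaningful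
(its order is `(normSubgroup).relIndex (fixedSubgroup)`). Our proof of the printed remark that `N`
lands in `E(F)`. [cite: KramerTunnell1982, Introduction (p. 307), "N … from E(K) to E(F)"; §5 (p. 326) E(F)/NE(K) ≅ Ĥ⁰(G, E(K))] -/
theorem normSubgroup_le_fixedSubgroup (hσ : σ * σ = 1) :
    normSubgroup E K' σ ≤ fixedSubgroup E K' σ := by
  rintro _ ⟨P, rfl⟩
  have h2 : WeierstrassCurve.Affine.Point.map (W' := E) (σ : K' →ₐ[F] K')
      (WeierstrassCurve.Affine.Point.map (W' := E) (σ : K' →ₐ[F] K') P) = P := by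
    rw [← map_mul_apply, hσ, map_one_apply]
  rw [mem_fixedSubgroup_iff]
  simp only [AddMonoidHom.add_apply, AddMonoidHom.id_apply, map_add, h2]
  exact add_comm _ _

end Defs

section Fact

open scoped Classical

/-- **Kramer–Tunnell 1982, Lemma 6.1, with the exact clause of its proof** (Compositio Math. 46,
§6, pp. 327–328; verbatim in the module docstring). Setting, as printed: `F` a local field with finite
residue field (any residue characteristic: "we could assume that `char(k_F) = 2`. However, we
present a uniform proof"), `E/F` an elliptic curve, `K/F` an UNRAMIFIED quadratic extension with
`G = Gal(K/F) = ⟨g⟩`, `N(P) = P + gP`, `M` the maximal unramified extension of `F`, `n` = the number of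
components of the singular fibre of (the Néron model of) `E` over `M`. Then
(i) [Lemma 6.1] "`dim E(F)/NE(K) ≡ n − 1 (mod 2)`" — typed: `#(E(K')^σ / N E(K')) = 2^d` with
`d ≡ n − 1 (mod 2)`; (ii) [proof of Lemma 6.1, first case] "For reductions of type `I_0`, `I_v` with
`v_F(Δ) = v` odd, `II`, `II*`, `IV`, `IV*`, `c` is odd and `n` is odd. Since `X` must be trivial,
`dim E(F)/NE(K) = 0`" — typed: for these Kodaira types the index is `1`, i.e. every `σ`-fixed point
is a norm. Vocabulary (module docstring): `F` a Mathlib nonarchimedean local field, `K'` an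
intermediate field of `F̄/F` inside the tree's `maxUnramified F` with `[K' : F] = 2`, `σ ≠ 1` in
`Aut(K'/F)`, the index as `AddSubgroup.relIndex`, `n = (E.kodairaSymbol 𝒪[F]).numComponents` (tree,
Tate's algorithm; geometric components). Named fact (PUBLISHED); nothing asserted; users take
`(h : lemma61_unramifiedNormIndex)`.
[cite: KramerTunnell1982, §6 Lemma 6.1 and its proof (pp. 327–328)] -/
def lemma61_unramifiedNormIndex : Prop :=
  ∀ (F : Type) [Field F] [ValuativeRel F] [TopologicalSpace F] [IsNonarchimedeanLocalField F]
    (E : WeierstrassCurve F) [E.IsElliptic]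
    (K' : IntermediateField F (AlgebraicClosure F)) (_hK' : K' ≤ maxUnramified F)
    (_h2 : Module.finrank F K' = 2) (σ : K' ≃ₐ[F] K') (_hσ : σ ≠ 1),
    (∃ d : ℕ, (normSubgroup E K' σ).relIndex (fixedSubgroup E K' σ) = 2 ^ d ∧
        d % 2 = ((E.kodairaSymbol 𝒪[F]).numComponents - 1) % 2) ∧
      ((E.kodairaSymbol 𝒪[F] = .I 0 ∨ (∃ v : ℕ, Odd v ∧ E.kodairaSymbol 𝒪[F] = .I v) ∨
          E.kodairaSymbol 𝒪[F] = .II ∨ E.kodairaSymbol 𝒪[F] = .IIstar ∨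
          E.kodairaSymbol 𝒪[F] = .IV ∨ E.kodairaSymbol 𝒪[F] = .IVstar) →
        (normSubgroup E K' σ).relIndex (fixedSubgroup E K' σ) = 1)

/-- **Consumable form of clause (ii)**: under the fact, for the odd-`c` reduction types of the printed
list every `σ`-fixed point of `E(K')` is a norm `P + σP` (relative index `1` means
`fixedSubgroup ≤ normSubgroup`, Mathlib `AddSubgroup.relIndex_eq_one`). This is the `δ_v = 0` input of
a Selmer transport at an unramified place, `v = 2` included. [cite: KramerTunnell1982, §6 proof of Lemma 6.1 (p. 327), "Since X must be trivial, dim E(F)/NE(K) = 0"] -/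
theorem lemma61_unramifiedNormIndex.fixed_le_norm (h : lemma61_unramifiedNormIndex)
    (F : Type) [Field F] [ValuativeRel F] [TopologicalSpace F] [IsNonarchimedeanLocalField F]
    (E : WeierstrassCurve F) [E.IsElliptic] (K' : IntermediateField F (AlgebraicClosure F))
    (hK' : K' ≤ maxUnramified F) (h2 : Module.finrank F K' = 2) (σ : K' ≃ₐ[F] K') (hσ : σ ≠ 1)
    (htype : E.kodairaSymbol 𝒪[F] = .I 0 ∨ (∃ v : ℕ, Odd v ∧ E.kodairaSymbol 𝒪[F] = .I v) ∨
      E.kodairaSymbol 𝒪[F] = .II ∨ E.kodairaSymbol 𝒪[F] = .IIstar ∨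
      E.kodairaSymbol 𝒪[F] = .IV ∨ E.kodairaSymbol 𝒪[F] = .IVstar) :
    fixedSubgroup E K' σ ≤ normSubgroup E K' σ :=
  AddSubgroup.relIndex_eq_one.mp ((h F E K' hK' h2 σ hσ).2 htype)

end Fact

end Literature.NumberTheory.EllipticCurves.KramerTunnell1982

end
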